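import Summits.BirchSwinnertonDyer.BirchSwinnertonDyer.Theorems.Rank1ResidualJetKolyvaginClassLocal
import HarnessLib

/-!
# Route `KolyvaginRankRigidityAtTwo`, crux V2♭ `KolyvaginCorankLowerBoundAtTwo`
# (stmt-BirchSwinnertonDyer-24623), sub-rung (i-b), BAD half: the BOUNDED DEFECT of the Selmer local
# condition of the concrete Kolyvagin class `c_M(m)` at a bad place `v ∤ m` — `n′ • c_M(m) ∈ Sel_v` with
# NO coprimality between `n′` and `p^M` (the form needed AT `p = 2`), modulo [GZ86 III (3.1)]

Width prover `bsd-line-krr2-p2` (g5), LEAD re-tasking 05:52Z («at v ∣ 2N the BOUNDED defect … state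
"2^t·c_M(n) is Selmer at v ∣ N", not "c_M(n) Selmer"»); `--supports stmt-BirchSwinnertonDyer-24623 --as
helper`. THEOREMS ONLY (no definition, no named fact, no `sorry`); BSD is not proved by any of this.

WHY. Gross 1991, Prop. 6.2 (1) at a BAD place `v ∤ m` (pp. 244–245) kills the image `d(m)_v` of `c_M(m)`
in `H¹(K_v, E)` in two steps: (b) the cocycle `σ ↦ −(σ−1)P_m/p^M` takes values in a subgroup `E′`
with `n′ • E′_v ⊆ E⁰(K_v^{un})` ([GZ86, III (3.1)]: "`y_n` is, up to translation by rational torsion,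
in `E⁰`"; `n′` = exponent of `E′/E⁰`), so `n′ • d(m)_v = 0` by Lang/Milne I.3.8 for `E⁰`
(`H¹(K_v^{un}/K_v, E⁰) = 0`); (c) `p^M • d(m)_v = 0`; hence `d(m)_v = 0` PROVIDED `(n′, p) = 1`. The
tree (x11b3 `GrossBadPlace.*`, JET `hloc_concrete_of_GZ31_zhang`) formalises exactly this with the
coprimality `hcop : IsCoprime p^M n′` as a binder. AT `p = 2` step (c) is lost whenever `n′` is even
(an even Tamagawa number, or `2 ∣ #E(ℚ)_tors` off the habitat) — the pen's KOLY2 caveat — and what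
survives is the BOUNDED DEFECT `n′ • c_M(m) ∈ selmerLocalKer`, uniformly in `m` and `M`: finite index
is invisible on `ℤ₂`-coranks (V2♭). This file proves that form, by replaying the tree's chain with
step (c) removed:

* §1 `zsmul_cls_mem_resKer_of_vanishing_of_zsmul_mem` — the abstract mechanism
  (`GrossBadPlace.cls_mem_resKer_of_vanishing_of_zsmul_mem` minus coprimality): `n′ • c(P; Q)` lies in
  the local kernel;
  `zsmul_kolyvaginClass_mem_selmerLocalKer_of_inertia_of_zsmul_mem` — the same for a Weierstrass
  curve over a number field at a finite place;
* §2 `zsmul_kolyvaginClass_kolyvaginPoint_mem_selmerLocalKer_of_GZ31(_E0)` — the END form for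
  Kolyvagin's point `P_m` with the binder `hGZ31` (receptacle `B`, resp. `E⁰(K̄_v)` with (α)
  discharged by `oneCocycleClass_eq_zero_of_mem_E0Receptacle`), NO `hcop`;
* (sequel file `…ClassesIntoSelmerBadDefectZhang`) `zsmul_kolyvaginClass_mem_selmerLocalKer_of_GZ31_zhang`
  — for the tree's CONCRETE data at the divisors of a square-free product `n` of ZHANG–Kolyvagin primes
  of index `≥ M` (any prime `p`, so `p = 2` included): at every finite place `v ∤ m`,
  **`n′ • c_M(m) ∈ selmerLocalKer (E/K) K_v p^M`**, modulo `hGZ31` and the admissibility `hA`.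

References (locators only): [cite: GrossLMS1991, §6 Prop. 6.2 (1), pp. 244–245; Prop. 3.7 (1), §3 (3.3),
§4 (4.1), Lemma 4.3] [cite: GrossZagier1986, III (3.1)] [cite: McCallumLMS1991, §4 Cor. 4.2, Lemma 4.3]
[cite: MilneADT2006, Ch. I Prop. 3.8] [cite: WZhang2014, Notations (xii)].
-/

set_option autoImplicit false
-- the Theorems namespace of this sub repeats the summit name by design (D-0017 nested layout)
set_option linter.dupNamespace false

noncomputable section

open scoped Classical
open scoped AddSubgroup

namespace Summit.BirchSwinnertonDyer.BirchSwinnertonDyer.Theorems.KolyvaginRankRigidity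

open WeierstrassCurve NumberField IsDedekindDomain Field Finset
  Literature.NumberTheory.EllipticCurves Literature.NumberTheory.GaloisRepresentations
  Literature.NumberTheory.EllipticCurves.KolyvaginCocycle
  Literature.NumberTheory.EllipticCurves.KolyvaginEuler
  Literature.NumberTheory.EllipticCurves.RingClassField
  Literature.NumberTheory.EllipticCurves.ModularForms
  Summit.BirchSwinnertonDyer.Rank1Residual.X11b Summit.BirchSwinnertonDyer.Rank1Residual.X11b.Three
  Summit.BirchSwinnertonDyer.Rank1Residual.X11b.Three.GrossBadPlace
  Summit.BirchSwinnertonDyer.Rank1Residual.X11b.KolyvaginHloc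

universe u

/-! ## §1 The mechanism without coprimality -/

section Abstract

variable {G : Type u} [Group G] [TopologicalSpace G] [IsTopologicalGroup G]
variable {M : Type u} [AddCommGroup M] [DistribMulAction G M] [TopologicalSpace M]
  [DiscreteTopology M]
variable {H : Type u} [Group H] [TopologicalSpace H] [IsTopologicalGroup H]
variable {M' : Type u} [AddCommGroup M'] [DistribMulAction H M'] [TopologicalSpace M']
  [DiscreteTopology M']
variable {A : AddSubgroup M} {n : ℤ}

/-- **Gross's mechanism at a bad place WITHOUT coprimality** (Prop. 6.2 (1), steps (a)–(b) only): for
a compatible pair `(θ : H → G, Ψ : M → M')`, if `θ(I)` fixes `P` (inertia; `K_n/K` unramified at `v`),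
`n′ • Ψ((θh−1)P/n) ∈ B` for every `h` and every `B`-valued continuous cocycle of `H` vanishing on `I`
has trivial class, then `n′ • c(P; Q)` lies in the kernel of `H¹(G, M[n]) → H¹(H, M')` (its image is
`n′ •` the class of `h ↦ −Ψ((θh−1)P/n)`, which is the class of a `B`-valued cocycle vanishing on `I`).
The tree's `GrossBadPlace.cls_mem_resKer_of_vanishing_of_zsmul_mem` is this followed by
`(n, n′) = 1`. [cite: GrossLMS1991, Prop. 6.2 (1)] [cite: McCallumLMS1991, Cor. 4.2, Lemma 4.3] -/
theorem zsmul_cls_mem_resKer_of_vanishing_of_zsmul_mem (θ : H →ₜ* G) (Ψ : M →+ M')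
    (hΨ : ∀ (h : H) (m : M), Ψ (θ h • m) = h • Ψ m)
    (hA : IsAdmissible G A n) (hcont : ∀ m : M, Continuous fun g : G ↦ g • m)
    {P : M} (hP : P ∈ invPoints G A n) {Q : M} (hQ : n • Q = P)
    (hc : ∀ (h : H) (x : M[n]),
      (Ψ.comp (M[n]).subtype) (θ h • x) = h • (Ψ.comp (M[n]).subtype) x)
    {I : Set H} (hI : ∀ σ ∈ I, θ σ • P = P)
    (B : AddSubgroup M') {n' : ℤ}
    (hval : ∀ h : H, n' • Ψ (rootIn A n (θ h • P - P)) ∈ B)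
    (hvanish : ∀ f : contOneCocycles (discreteTopRep H M'), (∀ h : H, f.1 h ∈ B) →
      (∀ σ ∈ I, f.1 σ = 0) → oneCocycleClass _ f = 0) :
    n' • cls hA hcont hP hQ ∈ resKer θ (Ψ.comp (M[n]).subtype) hc := by
  rw [mem_resKer_iff, map_zsmul, map_cls_eq_pullback_negRootCocycle θ Ψ hΨ hA hcont hP hQ hc,
    ← oneCocycleClassₗ_apply, ← map_zsmul, oneCocycleClassₗ_apply]
  refine hvanish _ (fun h ↦ ?_) (fun σ hσ ↦ ?_)
  · change n' • (contOneCocycles.pullback θ (resHomOfEquivariant θ Ψ hΨ)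
      (negRootCocycle hA hcont hP)).1 h ∈ B
    rw [contOneCocycles.pullback_apply, negRootCocycle_apply]
    change n' • Ψ (-rootIn A n (θ h • P - P)) ∈ B
    rw [map_neg, smul_neg]
    exact B.neg_mem (hval h)
  · change n' • (contOneCocycles.pullback θ (resHomOfEquivariant θ Ψ hΨ)
      (negRootCocycle hA hcont hP)).1 σ = 0
    rw [contOneCocycles.pullback_apply, negRootCocycle_apply, hI σ hσ, sub_self,
      rootIn_zero hA.eq_zero_of_zsmul, neg_zero]
    change n' • Ψ 0 = 0
    rw [map_zero, smul_zero]

end Abstract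

/-! ## §1′ The same for an elliptic curve at a finite place -/

section Curve

variable {K : Type u} [Field K] [NumberField K] (W : WeierstrassCurve K) {n : ℤ}
variable {hdiv : ∀ P : geomPoints W, ∃ Q : geomPoints W, n • Q = P}
variable {A : AddSubgroup (geomPoints W)}

/-- **Bounded defect at a finite place, abstract datum**: under the inputs of the tree's
`GrossBadPlace.kolyvaginClass_mem_selmerLocalKer_of_inertia_of_zsmul_mem` EXCEPT the coprimality of
`n′` with `n`, the multiple `n′ • c(P)` satisfies the Selmer local condition at `v`.
[cite: GrossLMS1991, Prop. 6.2 (1), pp. 244–245] [cite: McCallumLMS1991, Lemma 4.3] -/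
theorem zsmul_kolyvaginClass_mem_selmerLocalKer_of_inertia_of_zsmul_mem
    (hA : IsAdmissible (absoluteGaloisGroup K) A n) {P : geomPoints W}
    (hP : P ∈ invPoints (absoluteGaloisGroup K) A n)
    (v : HeightOneSpectrum (𝓞 K)) {𝔐 : Ideal (v.localAbsIntegers)}
    (hI : ∀ σ ∈ 𝔐.inertia (absoluteGaloisGroup (v.adicCompletion K)),
      resGal (K := K) (v.adicCompletion K) σ • P = P)
    (B : AddSubgroup (localPoints W (v.adicCompletion K))) {n' : ℤ}
    (hval : ∀ σ : absoluteGaloisGroup (v.adicCompletion K),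
      n' • pointsMap W (v.adicCompletion K)
        (rootIn A n (resGal (K := K) (v.adicCompletion K) σ • P - P)) ∈ B)
    (hvanish : ∀ f : contOneCocycles (discreteTopRep (absoluteGaloisGroup (v.adicCompletion K))
        (localPoints W (v.adicCompletion K))),
      (∀ σ, f.1 σ ∈ B) → (∀ σ ∈ 𝔐.inertia (absoluteGaloisGroup (v.adicCompletion K)), f.1 σ = 0) →
        oneCocycleClass _ f = 0) :
    n' • kolyvaginClass W n hdiv hA P hP ∈ selmerLocalKer W (v.adicCompletion K) n :=
  zsmul_cls_mem_resKer_of_vanishing_of_zsmul_mem (resGal (K := K) (v.adicCompletion K))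
    (pointsMap W (v.adicCompletion K)) (pointsMap_smul W (v.adicCompletion K)) hA _ hP _ _ hI B
    hval hvanish

/-- With Gross's `E′` explicit: roots in `E′ ≤ E(K̄_v)`, `n′ • E′ ⊆ B`, (α) for `B` ⟹
`n′ • c(P) ∈ selmerLocalKer`. [cite: GrossLMS1991, Prop. 6.2 (1), pp. 244–245] -/
theorem zsmul_kolyvaginClass_mem_selmerLocalKer_of_inertia_of_mem_of_zsmul_mem
    (hA : IsAdmissible (absoluteGaloisGroup K) A n) {P : geomPoints W}
    (hP : P ∈ invPoints (absoluteGaloisGroup K) A n)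
    (v : HeightOneSpectrum (𝓞 K)) {𝔐 : Ideal (v.localAbsIntegers)}
    (hI : ∀ σ ∈ 𝔐.inertia (absoluteGaloisGroup (v.adicCompletion K)),
      resGal (K := K) (v.adicCompletion K) σ • P = P)
    (E' B : AddSubgroup (localPoints W (v.adicCompletion K))) {n' : ℤ}
    (hE'B : ∀ x ∈ E', n' • x ∈ B)
    (hval : ∀ σ : absoluteGaloisGroup (v.adicCompletion K),
      pointsMap W (v.adicCompletion K)
        (rootIn A n (resGal (K := K) (v.adicCompletion K) σ • P - P)) ∈ E')
    (hvanish : ∀ f : contOneCocycles (discreteTopRep (absoluteGaloisGroup (v.adicCompletion K))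
        (localPoints W (v.adicCompletion K))),
      (∀ σ, f.1 σ ∈ B) → (∀ σ ∈ 𝔐.inertia (absoluteGaloisGroup (v.adicCompletion K)), f.1 σ = 0) →
        oneCocycleClass _ f = 0) :
    n' • kolyvaginClass W n hdiv hA P hP ∈ selmerLocalKer W (v.adicCompletion K) n :=
  zsmul_kolyvaginClass_mem_selmerLocalKer_of_inertia_of_zsmul_mem W hA hP v hI B
    (fun σ ↦ hE'B _ (hval σ)) hvanish

end Curve

/-! ## §2 The END form for Kolyvagin's point `P_m`, binder `hGZ31`, no coprimality -/

section End

variable {K : Type u} [Field K] [NumberField K] (W : WeierstrassCurve K) {n : ℤ}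
variable {hdiv : ∀ P : geomPoints W, ∃ Q : geomPoints W, n • Q = P}
variable {𝒢 : Type*} [CommGroup 𝒢] {A₀ : Type*} [AddCommGroup A₀] [DistribMulAction 𝒢 A₀]

/-- **Gross 1991 Prop. 6.2 (1) at a finite place `v ∤ m` for Kolyvagin's point, bounded-defect END
form**: the tree's `GrossBadPlace.kolyvaginClass_kolyvaginPoint_mem_selmerLocalKer_of_GZ31` with the
binder `hcop` REMOVED and the conclusion weakened to `n′ • c(jP_m) ∈ selmerLocalKer W K_v p^M`.
Inputs: the Euler-system data, `j` equivariant with admissible image, `[P_m]` invariant, inertia at `v`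
fixes `jP_m`, `hGZ31` (a `𝒢`-stable `E′ ∋ y_m` with `Tr_ℓ y_m ∈ p^M E′` and `n′ • (jE′)_v ⊆ B`) and (α)
for `B`. [cite: GrossLMS1991, Prop. 6.2 (1), pp. 244–245] [cite: GrossZagier1986, III (3.1)]
[cite: McCallumLMS1991, Lemma 4.3] -/
theorem zsmul_kolyvaginClass_kolyvaginPoint_mem_selmerLocalKer_of_GZ31
    {σ : ℕ → 𝒢} {L : Finset ℕ} {H : Subgroup 𝒢} [Fintype (𝒢 ⧸ H)] {f : 𝒢 ⧸ H → 𝒢}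
    (hf : ∀ q, (f q : 𝒢 ⧸ H) = q) (hgen : H ≤ Subgroup.closure (σ '' (L : Set ℕ)))
    (hord : ∀ ℓ ∈ L, σ ℓ ^ (ℓ + 1) = 1) (hdvd : ∀ ℓ ∈ L, n ∣ ((ℓ + 1 : ℕ) : ℤ)) {y : A₀}
    (π : absoluteGaloisGroup K →* 𝒢) (j : A₀ →+ geomPoints W)
    (hj : ∀ (g : absoluteGaloisGroup K) (a : A₀), j (π g • a) = g • j a)
    (hA : IsAdmissible (absoluteGaloisGroup K) j.range n)
    (hP : j (kolyvaginPoint σ L f y) ∈ invPoints (absoluteGaloisGroup K) j.range n)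
    (v : HeightOneSpectrum (𝓞 K)) {𝔐 : Ideal (v.localAbsIntegers)}
    (hI : ∀ τ ∈ 𝔐.inertia (absoluteGaloisGroup (v.adicCompletion K)),
      resGal (K := K) (v.adicCompletion K) τ • j (kolyvaginPoint σ L f y) =
        j (kolyvaginPoint σ L f y))
    {E' : AddSubgroup A₀} (B : AddSubgroup (localPoints W (v.adicCompletion K))) {n' : ℤ}
    (hGZ31 : (∀ (γ : 𝒢), ∀ e ∈ E', γ • e ∈ E') ∧ y ∈ E' ∧
      (∀ ℓ ∈ L, grAct A₀ (traceElt (σ ℓ) ℓ) y ∈ E'.map (zsmulAddGroupHom n : A₀ →+ A₀)) ∧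
      ∀ x ∈ E', n' • pointsMap W (v.adicCompletion K) (j x) ∈ B)
    (hvanish : ∀ c : contOneCocycles (discreteTopRep (absoluteGaloisGroup (v.adicCompletion K))
        (localPoints W (v.adicCompletion K))),
      (∀ τ, c.1 τ ∈ B) → (∀ τ ∈ 𝔐.inertia (absoluteGaloisGroup (v.adicCompletion K)), c.1 τ = 0) →
        oneCocycleClass _ c = 0) :
    n' • kolyvaginClass W n hdiv hA (j (kolyvaginPoint σ L f y)) hP ∈
      selmerLocalKer W (v.adicCompletion K) n := by
  obtain ⟨hE, hy, htr, hloc⟩ := hGZ31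
  have hroot : ∀ γ : 𝒢, γ • kolyvaginPoint σ L f y - kolyvaginPoint σ L f y ∈
      E'.map (zsmulAddGroupHom n : A₀ →+ A₀) :=
    KolyvaginRoot.smul_kolyvaginPoint_sub_mem_map hE hf hgen hord hdvd hy htr
  refine zsmul_kolyvaginClass_mem_selmerLocalKer_of_inertia_of_mem_of_zsmul_mem W hA hP v hI
    ((E'.map j).map (pointsMap W (v.adicCompletion K))) B ?_ ?_ hvanish
  · rintro _ ⟨_, ⟨x, hx, rfl⟩, rfl⟩
    exact hloc x hx
  · intro τ
    refine ⟨rootIn j.range n (resGal (K := K) (v.adicCompletion K) τ • j (kolyvaginPoint σ L f y) -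
      j (kolyvaginPoint σ L f y)), ?_, rfl⟩
    exact rootIn_smul_sub_mem_map_of_equivariant π j hj hA hroot _

/-- **The same with the receptacle `E⁰(K̄_v)` by name and (α) DISCHARGED** (all reduction types:
`oneCocycleClass_eq_zero_of_mem_E0Receptacle`, Milne *ADT* I.3.8 for `E⁰`): `n′ • c(jP_m) ∈ Sel_v`.
[cite: GrossLMS1991, Prop. 6.2 (1), pp. 244–245] [cite: MilneADT2006, Ch. I Prop. 3.8] -/
theorem zsmul_kolyvaginClass_kolyvaginPoint_mem_selmerLocalKer_of_GZ31_E0 [W.IsElliptic]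
    {σ : ℕ → 𝒢} {L : Finset ℕ} {H : Subgroup 𝒢} [Fintype (𝒢 ⧸ H)] {f : 𝒢 ⧸ H → 𝒢}
    (hf : ∀ q, (f q : 𝒢 ⧸ H) = q) (hgen : H ≤ Subgroup.closure (σ '' (L : Set ℕ)))
    (hord : ∀ ℓ ∈ L, σ ℓ ^ (ℓ + 1) = 1) (hdvd : ∀ ℓ ∈ L, n ∣ ((ℓ + 1 : ℕ) : ℤ)) {y : A₀}
    (π : absoluteGaloisGroup K →* 𝒢) (j : A₀ →+ geomPoints W)
    (hj : ∀ (g : absoluteGaloisGroup K) (a : A₀), j (π g • a) = g • j a)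
    (hA : IsAdmissible (absoluteGaloisGroup K) j.range n)
    (hP : j (kolyvaginPoint σ L f y) ∈ invPoints (absoluteGaloisGroup K) j.range n)
    (v : HeightOneSpectrum (𝓞 K)) {𝔐 : Ideal (v.localAbsIntegers)} (h𝔐 : 𝔐 ∈ v.localPrimesAbove)
    (hI : ∀ τ ∈ 𝔐.inertia (absoluteGaloisGroup (v.adicCompletion K)),
      resGal (K := K) (v.adicCompletion K) τ • j (kolyvaginPoint σ L f y) =
        j (kolyvaginPoint σ L f y))
    {E' : AddSubgroup A₀} {n' : ℤ}
    (hGZ31 : (∀ (γ : 𝒢), ∀ e ∈ E', γ • e ∈ E') ∧ y ∈ E' ∧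
      (∀ ℓ ∈ L, grAct A₀ (traceElt (σ ℓ) ℓ) y ∈ E'.map (zsmulAddGroupHom n : A₀ →+ A₀)) ∧
      ∀ x ∈ E', n' • pointsMap W (v.adicCompletion K) (j x) ∈ E0Receptacle W v) :
    n' • kolyvaginClass W n hdiv hA (j (kolyvaginPoint σ L f y)) hP ∈
      selmerLocalKer W (v.adicCompletion K) n :=
  zsmul_kolyvaginClass_kolyvaginPoint_mem_selmerLocalKer_of_GZ31 W hf hgen hord hdvd π j hj hA hP v
    hI (E0Receptacle W v) hGZ31 fun c hcB hcI ↦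
      oneCocycleClass_eq_zero_of_mem_E0Receptacle W v h𝔐 c hcB hcI

end End


end Summit.BirchSwinnertonDyer.BirchSwinnertonDyer.Theorems.KolyvaginRankRigidity

end
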